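import Mathlib
import Summits.PneNP.PneNP.Theses.OneSlice
import Summits.PneNP.PneNP.Theorems.OneSliceSliceTargetSplitTransport

/-!
# Sketch — crux `MonotoneContinuation` (stmt-PneNP-18471), crux-ideate round 1, ideator 1

First lemmas of the two idea cards (statements only; `sorry` bodies are allowed in a sketch):

* card `signed-hardcore-duality`: `rankPad`/`rankDel` (monotone rank padding / deletion maps),
  `transport_eq_avg_rankPad` (the transport below the slice is the average of `C ∘ rankPad` over orders),
  `monotoneHardcoreDichotomy` (Impagliazzo's hardcore lemma for the MONOTONE class w.r.t. `G(n,p)`),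
  `transportDecorrelation` (a two-sided-decorrelated dense tilt of `G(n,p)` cannot see `F ≈ ĝ`).
* card `one-sided-normal-form`: `LazyAbove`, `lazyAbove_continuation` (a lazy-above slice representative
  continues to the whole `G(n,p)` by an OR over padding amounts), `lazy_and`/`lazy_or`/`lazy_input`
  (the laziness calculus).
-/

set_option linter.dupNamespace false

namespace Summit.PneNP.PneNP.Cruxes.MonotoneContinuation.Sketch

open Literature.Computability.Complexity Finset Classical
open Summit.PneNP.PneNP.Theorems.ConstantBand.Negative (Edge slice)
open Summit.PneNP.PneNP.Theorems.SliceTargetSplit (transport ind l1 nbhd)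

noncomputable section

variable {n : ℕ}

/-! ## Rank padding and rank deletion (card `signed-hardcore-duality`, facts F3) -/

/-- `P^rank_r(y)`: `y` together with the first `r` edges (in `rank` order) that are absent from `y`. -/
def rankPad (rank : Edge n → ℕ) (r : ℕ) (y : Edge n → Bool) : Edge n → Bool :=
  fun e => y e || decide (#(univ.filter fun e' : Edge n => y e' = false ∧ rank e' < rank e) < r)

/-- `D^rank_d(y)`: `y` minus its first `d` present edges (in `rank` order). -/
def rankDel (rank : Edge n → ℕ) (d : ℕ) (y : Edge n → Bool) : Edge n → Bool :=
  fun e => y e && decide (d ≤ #(univ.filter fun e' : Edge n => y e' = true ∧ rank e' < rank e))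

/-- Rank padding is coordinatewise monotone in `y` (for FIXED `r`): the set of absent edges preceding `e`
shrinks when `y` grows. -/
theorem rankPad_monotone (rank : Edge n → ℕ) (r : ℕ) : Monotone (rankPad (n := n) rank r) := by
  sorry

/-- Rank deletion is coordinatewise monotone in `y` (for FIXED `d`). -/
theorem rankDel_monotone (rank : Edge n → ℕ) (d : ℕ) : Monotone (rankDel (n := n) rank d) := by
  sorry

/-- With an injective `rank`, padding by `r ≤ N - |y|` lands exactly `r` levels up. -/
theorem edgeCount_rankPad (rank : Edge n → ℕ) (hrank : Function.Injective rank) (r : ℕ) (y : Edge n → Bool)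
    (hr : r + edgeCount y ≤ n.choose 2) : edgeCount (rankPad rank r y) = edgeCount y + r := by
  sorry

/-- The transport below the slice is the average of `g ∘ rankPad` over all orders (`σ` ranges over the
permutations of the edge set, `rank := enum ∘ σ`): a uniformly ordered padding is a uniform `r`-subset of the
absent edges, i.e. a uniform slice-`j` superset. -/
theorem transport_eq_avg_rankPad (j : ℕ) (g : (Edge n → Bool) → ℝ) (y : Edge n → Bool) (hy : edgeCount y ≤ j)
    (hj : j ≤ n.choose 2) :
    transport j g y =
      (∑ σ : Equiv.Perm (Edge n), g (rankPad (fun e => (Fintype.equivFin (Edge n) (σ e) : ℕ)) (j - edgeCount y) y)) /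
        (Fintype.card (Equiv.Perm (Edge n)) : ℝ) := by
  sorry

/-! ## Tilted measures and the monotone hardcore dichotomy (card `signed-hardcore-duality`, fact F8) -/

/-- Expectation under the tilt `H = w · G(n,p) / E[w]` of `G(n,p)` by a weight `w : cube → [0,1]`. -/
def tiltExp (n : ℕ) (p : ℝ) (w f : (Edge n → Bool) → ℝ) : ℝ :=
  (∑ y, gnpWeight n p y * w y * f y) / ∑ y, gnpWeight n p y * w y

/-- `w` is a `δ`-DENSE weight: values in `[0,1]` and `G(n,p)`-mass at least `δ`. -/
def DenseWeight (n : ℕ) (p δ : ℝ) (w : (Edge n → Bool) → ℝ) : Prop :=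
  (∀ y, 0 ≤ w y ∧ w y ≤ 1) ∧ δ ≤ ∑ y, gnpWeight n p y * w y

/-- **Monotone hardcore dichotomy** (Impagliazzo's hardcore lemma, min-max form, run for the class of MONOTONE
circuits — the majority of `t` monotone circuits is a monotone circuit — and w.r.t. the base measure `G(n,p)`
instead of the uniform one; Arora–Barak Lemma 19.3, pp. 442–445). Either some `δ`-dense tilt is `ε₁`-hardcore
for `F` against monotone circuits of size `≤ S'`, or a monotone circuit of size `≤ t·(S'+1) + t²`,
`t = ⌈50·C(n,2)/ε₁²⌉`, computes `F` off a set of `G(n,p)`-mass `≤ δ`. -/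
theorem monotoneHardcoreDichotomy (n : ℕ) (p : ℝ) (hp0 : 0 ≤ p) (hp1 : p ≤ 1) (F : (Edge n → Bool) → Bool)
    (δ ε₁ : ℝ) (hδ : 0 < δ) (hε : 0 < ε₁) (S' : ℕ) :
    (∃ w : (Edge n → Bool) → ℝ, DenseWeight n p δ w ∧
        ∀ X : Circuit (Edge n), X.IsOver monotoneBasis → X.size ≤ S' →
          tiltExp n p w (fun y => if X.eval y = F y then 1 else 0) ≤ 1 / 2 + ε₁) ∨
    (∃ M : Circuit (Edge n), M.IsOver monotoneBasis ∧
        M.size ≤ ⌈50 * (n.choose 2 : ℝ) / ε₁ ^ 2⌉₊ * (S' + 1) + ⌈50 * (n.choose 2 : ℝ) / ε₁ ^ 2⌉₊ ^ 2 ∧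
        l1 n p (ind M.eval) (ind F) ≤ δ) := by
  sorry

/-- **Transport decorrelation** (the new lemma of card `signed-hardcore-duality`). Let `C` be monotone,
`ĝ := transport j (ind C.eval)`, `F` Boolean, and `H` the tilt of `G(n,p)` by a weight `w` such that
(i) `F` is `ε₁`-balanced on `H` and (ii) every rank-padding / rank-deletion test
`y ↦ [ℓ ≤ |y|] ∧ C(P^rank_r y)`, `y ↦ [ℓ ≤ |y|] ∧ C(D^rank_d y)` is TWO-SIDEDLY `ε₁`-decorrelated from `F` on `H`.
Then `E_H[F·ĝ] ≤ E_H[ĝ]/2 + 4(b-a+2)ε₁ + H(|y| ∉ [a,b])` for every window `[a,b]`: on such an `H`, `F` cannot be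
`L¹(H)`-close to `ĝ` (take `[a,b]` = the `√m log m` shell and `ε₁ = 1/m`). Proof: `1_{|y|=ℓ} = T_ℓ - T_{ℓ+1}` and
`ĝ = Σ_ℓ 1_ℓ · avg_σ C∘P^σ_{j-ℓ}` (`transport_eq_avg_rankPad`), term by term. -/
theorem transportDecorrelation (n : ℕ) (p : ℝ) (hp0 : 0 ≤ p) (hp1 : p ≤ 1) (j a b : ℕ) (ε₁ : ℝ)
    (C : Circuit (Edge n)) (hC : C.IsOver monotoneBasis) (F : (Edge n → Bool) → Bool)
    (w : (Edge n → Bool) → ℝ) (hw : ∀ y, 0 ≤ w y ∧ w y ≤ 1) (hwpos : 0 < ∑ y, gnpWeight n p y * w y)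
    (hbal : |tiltExp n p w (ind F) - 1 / 2| ≤ ε₁)
    (hpad : ∀ (rank : Edge n → ℕ), Function.Injective rank → ∀ ℓ r : ℕ,
      |tiltExp n p w (fun y => ind F y * ind (fun y => decide (ℓ ≤ edgeCount y) && C.eval (rankPad rank r y)) y) -
        tiltExp n p w (ind fun y => decide (ℓ ≤ edgeCount y) && C.eval (rankPad rank r y)) / 2| ≤ ε₁)
    (hdel : ∀ (rank : Edge n → ℕ), Function.Injective rank → ∀ ℓ d : ℕ,
      |tiltExp n p w (fun y => ind F y * ind (fun y => decide (ℓ ≤ edgeCount y) && C.eval (rankDel rank d y)) y) -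
        tiltExp n p w (ind fun y => decide (ℓ ≤ edgeCount y) && C.eval (rankDel rank d y)) / 2| ≤ ε₁) :
    tiltExp n p w (fun y => ind F y * transport j (ind C.eval) y) ≤
      tiltExp n p w (transport j (ind C.eval)) / 2 + 4 * ((b : ℝ) - a + 2) * ε₁ +
        tiltExp n p w (fun y => if edgeCount y < a ∨ b < edgeCount y then 1 else 0) := by
  sorry

/-! ## One-sided normal forms (card `one-sided-normal-form`, facts F4–F6) -/

/-- Switch on a finite set of edges. -/
def addSet (x : Edge n → Bool) (S : Finset (Edge n)) : Edge n → Bool := fun e => x e || decide (e ∈ S)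

/-- The `r`-paddings of `x`: `r`-subsets of the absent edges. -/
def paddings (x : Edge n → Bool) (r : ℕ) : Finset (Finset (Edge n)) :=
  (univ.filter fun e => x e = false).powersetCard r

/-- **Lazy above the slice** up to distance `rmax` with defect `θ`: padding a REJECTED slice-`j` point by `r ≤ rmax`
uniformly random absent edges triggers acceptance with (joint) probability at most `θ`. One-sided, local to the
slice, and closed under the laziness calculus below. -/
def LazyAbove (C : Circuit (Edge n)) (j rmax : ℕ) (θ : ℝ) : Prop :=
  ∀ r, 1 ≤ r → r ≤ rmax →
    (∑ x ∈ slice n j, ∑ S ∈ paddings x r,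
        (if C.eval x = false ∧ C.eval (addSet x S) = true then (1 : ℝ) else 0)) ≤
      θ * ∑ x ∈ slice n j, (#(paddings x r) : ℝ)

/-- Laziness calculus, inputs: a single variable is `r/(N-j)`-lazy. -/
theorem lazy_input (e : Edge n) (j rmax : ℕ) (hj : j < n.choose 2) :
    LazyAbove (Circuit.input e : Circuit (Edge n)) j rmax ((rmax : ℝ) / ((n.choose 2 : ℝ) - j)) := by
  sorry

/-- Laziness calculus, AND: spurious acceptance of `A ∧ B` needs spurious acceptance of the conjunct that was `0`;
defects at most add (in fact `≤` each defect restricted to its own rejection set). Stated for the slice functions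
through any monotone circuits `A`, `B`, `AB` with `AB ≡ A ∧ B`. -/
theorem lazy_and (A B AB : Circuit (Edge n)) (hAB : ∀ x, AB.eval x = (A.eval x && B.eval x)) (j rmax : ℕ)
    (θA θB : ℝ) (hA : LazyAbove A j rmax θA) (hB : LazyAbove B j rmax θB) : LazyAbove AB j rmax (θA + θB) := by
  sorry

/-- Laziness calculus, OR: defects add. -/
theorem lazy_or (A B AB : Circuit (Edge n)) (hAB : ∀ x, AB.eval x = (A.eval x || B.eval x)) (j rmax : ℕ)
    (θA θB : ℝ) (hA : LazyAbove A j rmax θA) (hB : LazyAbove B j rmax θB) : LazyAbove AB j rmax (θA + θB) := by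
  sorry

/-- **Lazy-above continuation** (first lemma of card `one-sided-normal-form`). If `Cl` is monotone, agrees with the
slice-`j` function of `C` up to slice-measure `η'`, and is `(2·rmax, θ)`-lazy above (distance `2·rmax`: a level-`(j+d)` point over-padded by `r`
is a slice point padded by `d + r`), then — provided the transport
`ĝ` of `C`'s slice function is `ε`-close in `L¹(G(n,p))` to a Boolean function (near-Booleanness; monotonicity of
that function is NOT needed here) and `G(n,p)` puts mass `≥ 1 - τ` on levels `[j - rmax, j + rmax]` — the OR over
padding amounts `C' := ⋁_{r ≤ rmax} [avg_σ Cl ∘ P^σ_r ≥ 3/4]` (derandomised: `s` orders) is a monotone circuit of size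
`≤ (rmax+1)·s·(Cl.size + 8·N²) + (rmax+1)·s²` with `‖C' - ĝ‖_{L¹(G(n,p))} ≤ 8(ε + η' + (2rmax+1)·θ) + τ + 2^{-s/64}·2^N`.
Mechanism: below the slice under-padded terms are `≤ ĝ` (F4), the exact term is `ĝ`, over-padded terms are
controlled by laziness; above the slice `Cl` itself is correct (lazy ⇒ no spurious acceptance; monotone ⇒ no miss). -/
theorem lazyAbove_continuation (n : ℕ) (p : ℝ) (hp0 : 0 ≤ p) (hp1 : p ≤ 1) (j rmax s : ℕ) (θ η' ε τ : ℝ)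
    (C Cl : Circuit (Edge n)) (hC : C.IsOver monotoneBasis) (hCl : Cl.IsOver monotoneBasis)
    (hslice : (∑ x ∈ slice n j, |ind Cl.eval x - ind C.eval x|) ≤ η' * #(slice n j))
    (hlazy : LazyAbove Cl j (2 * rmax) θ)
    (hbool : ∃ G : (Edge n → Bool) → Bool, l1 n p (ind G) (transport j (ind C.eval)) ≤ ε)
    (hmass : (∑ y ∈ univ.filter (fun y : Edge n → Bool => edgeCount y + rmax < j ∨ j + rmax < edgeCount y),
        gnpWeight n p y) ≤ τ) :
    ∃ C' : Circuit (Edge n), C'.IsOver monotoneBasis ∧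
      C'.size ≤ (rmax + 1) * s * (Cl.size + 8 * (n.choose 2) ^ 2) + (rmax + 1) * s ^ 2 ∧
      l1 n p (ind C'.eval) (transport j (ind C.eval)) ≤
        8 * (ε + η' + (2 * rmax + 1) * θ) + τ + (2 : ℝ) ^ (-(s : ℝ) / 64) * 2 ^ (n.choose 2) := by
  sorry

/-- **Exact one-level continuation** (fact F5; no hypothesis on `C` at all): on level `j+1` the rounding
`[ĝ ≥ θ]` of the transport is computed EXACTLY by the threshold-`⌈N - (1-θ)(j+1)⌉` vote of the `N` monotone maps
`y ↦ C(y ∖ e)`; the off-slice votes `C(y)` (for `e ∉ y`) are dominated: `C(y) = 1` is forced as soon as one deletion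
is accepted. Cost `×N` per level, hence useless beyond `O(1)` levels — recorded as the reason gluing, not level-wise
complexity, is the content of the crux. -/
theorem exactOneLevelUp (C : Circuit (Edge n)) (hC : C.IsOver monotoneBasis) (j : ℕ) (hj : j + 1 ≤ n.choose 2)
    (θ : ℝ) (hθ0 : 0 < θ) (hθ1 : θ ≤ 1) (y : Edge n → Bool) (hy : edgeCount y = j + 1) :
    (θ ≤ transport j (ind C.eval) y) ↔
      ((n.choose 2 : ℝ) - (1 - θ) * (j + 1) ≤
        #(univ.filter fun e : Edge n => C.eval (fun e' => y e' && decide (e' ≠ e)) = true)) := by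
  sorry


/-! ## Aborting KW protocols (card `aborting-kw-protocol`) -/

/-- **Veto uniformity** (the exchangeability identity behind the aborting protocol): whatever edge `e` of a
slice point `x` a (deterministic, `C`-derived) selector returns, exactly `C(j-1, r-1)` of the `C(j, r)` possible
`r`-subsets of `x` contain it — so when the padding `R ⊆ x` is conditionally uniform given `x` (true under the
unconditioned `G(n,p)` prior), the veto probability `Pr[e ∈ R]` is `r/j` for EVERY selector. -/
theorem veto_uniform (j r : ℕ) (x : Edge n → Bool) (hx : edgeCount x = j) (e : Edge n) (he : e ∈ Summit.PneNP.PneNP.Theorems.SliceACZero.Negative.supp x)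
    (hr : 1 ≤ r) :
    #(((Summit.PneNP.PneNP.Theorems.SliceACZero.Negative.supp x).powersetCard r).filter fun S => e ∈ S) = (j - 1).choose (r - 1) := by
  sorry

open Summit.PneNP.PneNP.Theorems.SliceTargetSplit (ofSet) in
/-- Downward acceptance fraction at co-distance `r`: `F̌_r(x) = Pr_{z ⊂ x, |z| = |x| - r}[G z]`. -/
def downFrac (r : ℕ) (G : (Edge n → Bool) → Bool) (x : Edge n → Bool) : ℝ :=
  (#(((Summit.PneNP.PneNP.Theorems.SliceACZero.Negative.supp x).powersetCard (edgeCount x - r)).filter fun s => G (ofSet s) = true) : ℝ) /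
    #((Summit.PneNP.PneNP.Theorems.SliceACZero.Negative.supp x).powersetCard (edgeCount x - r))

/-- **Fragile-boundary mass, Markov form** (provable now; the polynomial bound that `FBD` must beat): for an
UP-closed `G`, the slice-`j` mass of points of `G` whose downward fraction is `≤ τ < 1` is at most the
level-density increment of `G` from level `j - r` to level `j`, divided by `1 - τ` (flatness of transport images
makes the increment `O(ε)`, never `n^{-ω(1)}`). -/
theorem fragile_mass_markov (j r : ℕ) (hr : r ≤ j) (τ : ℝ) (hτ : τ < 1) (G : (Edge n → Bool) → Bool)
    (hG : Monotone G) :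
    (1 - τ) * #((slice n j).filter fun x => G x = true ∧ downFrac r G x ≤ τ) ≤
      (#((slice n j).filter fun x => G x = true) : ℝ) -
        (#((slice n (j - r)).filter fun z => G z = true) : ℝ) * ((#(slice n j) : ℝ) / #(slice n (j - r))) := by
  sorry

/-- **FBD — Fragile Boundary Decay** (the residual conjecture-lemma of card `aborting-kw-protocol`; circuit-free
in its conclusion): for the good set `G := [ĝ ≥ 1/2]` of a small monotone circuit's slice function whose transport
is near-monotone-Boolean, the slice mass of the FRAGILE boundary `{x : 0 < F̌_r(x) ≤ 2r/j}` is super-polynomially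
small, uniformly over central `j` and `r ≤ 3 m^{3/4}` (stated at a fixed polynomial rate `n^{-a}` for every `a`). -/
def FBD : Prop :=
  ∀ c a : ℕ, ∀ k : ℕ, 3 ≤ k → ∃ ε : ℝ, 0 < ε ∧ ∀ᶠ n : ℕ in Filter.atTop, ∀ j r : ℕ,
    Summit.PneNP.PneNP.Theorems.ConstantBand.Negative.Central k n j →
    (r : ℝ) ≤ 3 * (Summit.PneNP.PneNP.Theorems.ConstantBand.Negative.thr k n : ℝ) ^ ((3 : ℝ) / 4) →
    ∀ C : Circuit (Edge n), C.IsOver monotoneBasis → C.size ≤ n ^ c →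
      (∃ F : (Edge n → Bool) → Bool, Monotone F ∧
        l1 n (Summit.PneNP.PneNP.Theorems.SingleThreshold.Negative.pc n k) (ind F) (transport j (ind C.eval)) ≤ ε) →
      (#((slice n j).filter fun x =>
          0 < downFrac r (fun z => decide ((1 : ℝ) / 2 ≤ transport j (ind C.eval) z)) x ∧
            downFrac r (fun z => decide ((1 : ℝ) / 2 ≤ transport j (ind C.eval) z)) x ≤ 2 * (r : ℝ) / j) : ℝ) ≤
        (n : ℝ) ^ (-(a : ℝ)) * #(slice n j)

end

end Summit.PneNP.PneNP.Cruxes.MonotoneContinuation.Sketch
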